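import Summits.ValiantsHypothesis.ValiantsHypothesis.Theorems.LacunarySymmetroidMatrixDescartesCensusTropicalKLawSlopes

/-!
# Route «KPlusLogSqLaw», crux `TropicalB` (stmt-ValiantsHypothesis-19771) — DEFINITIONS of the explicit `m = 2` family with
# `4K − 7` sign-alternating dominant breakpoints (objects only; the proofs are in `…TropicalBTwoRowFamily`)

HONEST FRAMING.  Definitions file (seat val-sym-trop-p4 (g2), cell `pub-symmetroid`, 2026-08-26) for a SMALL-FORMAT lower-bound family
(`m = 2`, every `K ≥ 3`); nothing here or in the companion proof file bears on `TropicalB` in its window, `WeakLifting`,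
`MatrixDescartes` (stmt-ValiantsHypothesis-18050) or VP ≠ VNP.

THE FAMILY (`M = 4K²`, exponents `d_l = M·l + l²`): the diagonal entries `(0,0)`, `(1,1)` carry all `K` classes, the off-diagonal
entries `(1,0)`, `(0,1)` the classes `1 … K−2`; valuations `v(0,0,a) = d_a²`, `v(1,1,b) = (d_{K−1}+d_b)² − d_{K−1}²`,
`v(1,0,a) = (d_a+d_1)²`, `v(0,1,b) = (d_{K−2}+d_b)² − (d_{K−2}+d_1)²` (chain terms ON the parabola `∑ v = slope²`, all other present
terms `≥ 2M²` below); signs `ε(0,0,0) = 1`, `ε(0,0,a) = −1 (a ≥ 1)`, `ε(1,1,K−2) = −1`, `ε(1,1,b) = 1` otherwise, `ε(1,0,·) = 1`,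
`ε(0,1,·) = −1` on `1 … K−2` (else `0`).  The chain of `4K − 6` terms `A₀, A₁, B₂, A₂, …, B_{2K−4}, A_{2K−4}, A_{2K−3}, A_{2K−2}`:
identity terms `A_r` along the hook `(r,0)` / `(K−1, r+1−K)`, transposition terms `B_r` along the inner hook `(r−1,1)` / `(K−2, r+2−K)`;
term `k` is a transposition term iff `2 ≤ k ≤ 4K−9` and `k` is even; `rk`, `ca`, `cb` give its rank and classes, `xN`/`xZ` its slope.
[this seat's construction; folklore technique]
-/

set_option linter.dupNamespace false
set_option autoImplicit false

namespace Summit.ValiantsHypothesis.ValiantsHypothesis.Theorems.KPlusLogSqLaw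

namespace TwoRowFamily

/-! ## 1. The design (all data as functions of `K` on natural-number class indices) -/

/-- the scale `M = 4K²`. -/
def M (K : ℕ) : ℕ := 4 * K ^ 2

/-- exponents `d_l = M·l + l²`. -/
def dN (K l : ℕ) : ℕ := M K * l + l ^ 2

/-- the exponent vector. -/
def dd (K : ℕ) : Fin K → ℕ := fun l => dN K l

/-- valuations on natural class indices: `(0,0)`, `(0,1)`, `(1,0)`, `(1,1)`. -/
def vN (K : ℕ) (i j : Fin 2) (l : ℕ) : ℤ :=
  if i = 0 then
    (if j = 0 then ((dN K l : ℕ) : ℤ) ^ 2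
     else (((dN K (K - 2) : ℕ) : ℤ) + dN K l) ^ 2 - (((dN K (K - 2) : ℕ) : ℤ) + dN K 1) ^ 2)
  else
    (if j = 0 then (((dN K l : ℕ) : ℤ) + dN K 1) ^ 2
     else (((dN K (K - 1) : ℕ) : ℤ) + dN K l) ^ 2 - (((dN K (K - 1) : ℕ) : ℤ)) ^ 2)

/-- the valuation tensor. -/
def vv (K : ℕ) : Fin 2 → Fin 2 → Fin K → ℤ := fun i j l => vN K i j l

/-- signs on natural class indices. -/
def eN (K : ℕ) (i j : Fin 2) (l : ℕ) : ℤ :=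
  if i = 0 then
    (if j = 0 then (if l = 0 then 1 else -1)
     else (if 1 ≤ l ∧ l + 2 ≤ K then -1 else 0))
  else
    (if j = 0 then (if 1 ≤ l ∧ l + 2 ≤ K then 1 else 0)
     else (if l + 2 = K then -1 else 1))

/-- the sign tensor. -/
def ee (K : ℕ) : Fin 2 → Fin 2 → Fin K → ℤ := fun i j l => eN K i j l

/-- all signs lie in `{−1, 0, 1}`. -/
theorem ee_natAbs (K : ℕ) : ∀ i j l, (ee K i j l).natAbs ≤ 1 := by
  intro i j l
  unfold ee eN
  split_ifs <;> simp

/-! ## 2. The chain: ranks, types, classes -/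

/-- number of chain terms minus one: `n = 4K − 7`. -/
def nn (K : ℕ) : ℕ := 4 * K - 7

/-! Chain term `k` is a TRANSPOSITION term iff `2 ≤ k ≤ 4K − 9` and `k` is even (condition written inline below). -/

/-- total exponent rank of chain term `k`. -/
def rk (K k : ℕ) : ℕ := if k = 0 then 0 else if k + 9 ≤ 4 * K then (k + 2) / 2 else k + 5 - 2 * K

/-- class of column `0` of chain term `k`. -/
def ca (K k : ℕ) : ℕ :=
  if 2 ≤ k ∧ k + 9 ≤ 4 * K ∧ k % 2 = 0 then (if rk K k + 1 ≤ K then rk K k - 1 else K - 2)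
  else (if rk K k + 1 ≤ K then rk K k else K - 1)

/-- class of column `1` of chain term `k`. -/
def cb (K k : ℕ) : ℕ :=
  if 2 ≤ k ∧ k + 9 ≤ 4 * K ∧ k % 2 = 0 then (if rk K k + 1 ≤ K then 1 else rk K k + 2 - K)
  else (if rk K k + 1 ≤ K then 0 else rk K k + 1 - K)

/-- the column-`0` class is a class (`< K`). -/
theorem ca_lt (K k : ℕ) (hK : 3 ≤ K) : ca K k < K := by
  unfold ca rk; split_ifs <;> omega

/-- the column-`1` class is a class (`< K`). -/
theorem cb_lt (K k : ℕ) (hK : 3 ≤ K) (hk : k ≤ 4 * K - 7) : cb K k < K := by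
  unfold cb rk; split_ifs <;> omega

/-- slope of chain term `k` (natural number). -/
def xN (K k : ℕ) : ℕ := dN K (ca K k) + dN K (cb K k)

/-- the slope sequence on `Fin (n + 1)`, as integers. -/
def xZ (K : ℕ) (k : Fin (nn K + 1)) : ℤ := ((xN K k : ℕ) : ℤ)

/-- indices of `Fin (n + 1)` are `≤ 4K − 7`. -/
theorem le_of_fin (K : ℕ) (k : Fin (nn K + 1)) : (k : ℕ) ≤ 4 * K - 7 := by
  have := k.isLt; unfold nn at this; omega

/-- chain term with a natural-number index. -/
def termN (K : ℕ) (hK : 3 ≤ K) (k : ℕ) (hk : k ≤ 4 * K - 7) : Equiv.Perm (Fin 2) × (Fin 2 → Fin K) :=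
  (if 2 ≤ k ∧ k + 9 ≤ 4 * K ∧ k % 2 = 0 then Equiv.swap 0 1 else 1,
   fun i => if i = 0 then ⟨ca K k, ca_lt K k hK⟩ else ⟨cb K k, cb_lt K k hK hk⟩)

/-- the chain. -/
def term (K : ℕ) (hK : 3 ≤ K) (k : Fin (nn K + 1)) : Equiv.Perm (Fin 2) × (Fin 2 → Fin K) :=
  termN K hK k (le_of_fin K k)

end TwoRowFamily

end Summit.ValiantsHypothesis.ValiantsHypothesis.Theorems.KPlusLogSqLaw
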